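import Summits.FinalStateConjecture.FinalStateConjecture.Theorems.StarvedNecksNecksCertifyStubSeamSurgerySquash
import Summits.FinalStateConjecture.FinalStateConjecture.Theorems.StarvedNecksNecksCertifyStubSeamSurgeryGlue
import Summits.FinalStateConjecture.FinalStateConjecture.Theorems.StarvedNecksNecksCertifyStubSeamSurgerySmoothing
import Summits.FinalStateConjecture.FinalStateConjecture.Theorems.StarvedNecksSeamedChartsExhaustRide

/-!
# Route StarvedNecks — crux `NecksCertify`, line `two-cap-focusing-ledger`: seam surgery, the new hole chart

Helper file for the registered stub `stub_seamSurgery` (N2): assembling, for ONE hole of the input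
decomposition, the new chart of the seamed decomposition from the atlas data — the push profile of
`…Smoothing`, the lab-frame radial squash of `…Squash` (shell radius `b`, a smooth monotone
function within `[Rg + 21/20, Rg + 29/20]` of the certified radius), and the gluing theorem of
`…Glue`, with the ONE-ATLAS agreement on the collar shell derived from clause A3 and the collar
bookkeeping (`exists_holeChart`); plus the horizon bound `r₊ ≤ 2M`
(`stub_seamSurgery_rPlus`, registered helper sub-goal).

Mathlib + the landed seam helper modules; no definitions, no named facts.
-/

noncomputable section

open scoped Manifold ContDiff Topology ENNReal
open Filter Set Function Topology Literature.Geometry.Lorentzian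

namespace Summit.FinalStateConjecture.FinalStateConjecture.Theorems.NecksCertifyTwoCap.Seam

set_option linter.dupNamespace false

open Summit.FinalStateConjecture.FinalStateConjecture.Theorems.SeamedChartsExhaust.WideAnchoring
  (radius_add_smul_e₀ poincareInv_add_smul)

/-- Registered helper sub-goal `stub_seamSurgery_rPlus` of N2: the outer horizon radius is at most
`2M` (`r₊ = M + √(M² − a²)`), so the hole domains `{r > r₊}` contain `{r > R₁}` once `100M ≤ R₁`.
[folklore] -/
theorem stub_seamSurgery_rPlus : ∀ (M a : ℝ), 0 ≤ M → Kerr.rPlus M a ≤ 2 * M := by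
  intro M a hM
  unfold Kerr.rPlus
  have h1 : √(M ^ 2 - a ^ 2) ≤ √(M ^ 2) := Real.sqrt_le_sqrt (by nlinarith [sq_nonneg a])
  rw [Real.sqrt_sq hM] at h1
  linarith

section HoleChart

variable {𝓢 : Spacetime 4}

/-- **The new chart of one hole.**  For a hole with motion `(Λ, c)`, mass `M`, spin `a`
(background `B`, rest-frame time `t`, radius `r`), certified radii `Rg` (monotone, continuous,
`≥ R₁ + 4`), a smooth monotone shell radius `b ∈ [Rg + 21/20, Rg + 29/20]`, a clock shift `s ≥ 0`,
a squash profile `g`, the re-gauged chart `Ψ'` of the atlas (A1 on `U = {τ₁ < t, r < Rg(t) + 2}`;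
ONE ATLAS A3 with the flat chart `Φ` at flat-late points outside the tubes, abstracted as a
predicate `P`; the collar `{t > τ₁ + 1 + s, Rg + 17/20 < r < Rg + 2}` consists of flat-late points
outside the tubes), there are the squash data `σ, G` of `exists_labSquash` (`r₀ = R₁ + 4`) and a
glued chart `Gl` (`exists_gluedChart` with the push of `exists_pushProfile (τ₁ + 1 + s)`):
`C^∞` on the whole domain, `= Ψ'` on `{t ≥ τ₁ + 2 + s, r < b(t)}`, `= Φ ∘ G` on
`{t ≥ τ₁ + 2 + s, r ≥ b(t)}`, an open embedding of every late region, with image in `O`.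
[folklore] -/
theorem exists_holeChart (O : Set 𝓢.carrier) (Λ : lorentzGroup) (c : E4)
    (M a R₁ τ₁ s τf : ℝ) :
    let B := boostedKerrBackground Λ c M a
    ∀ (hR₁ : 0 < R₁ + 4) (hs : 0 ≤ s) (hτ : τf ≤ τ₁)
      (hdomR : ∀ y : E4, R₁ + 4 < B.radius y → y ∈ B.domain)
      (hdompos : ∀ y : E4, y ∈ B.domain → 0 < B.radius y)
      (hdomeq : ∀ y y' : E4, B.radius y' = B.radius y → y ∈ B.domain → y' ∈ B.domain)
      (Rg : ℝ → ℝ) (hRgm : Monotone Rg) (hRgc : Continuous Rg) (hRg4 : ∀ t, R₁ + 4 ≤ Rg t)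
      (b : ℝ → ℝ) (hb : ContDiff ℝ ∞ b) (hbm : Monotone b)
      (hbRg : ∀ t, Rg t + 21 / 20 ≤ b t ∧ b t ≤ Rg t + 29 / 20)
      (g : ℝ → ℝ) (L : ℝ) (hg : ContDiff ℝ ∞ g) (hgm : StrictMono g)
      (hgid : ∀ u, u ≤ 0 → g u = u) (hgb : ∀ u, g u < 1 / 2)
      (hgl : ∀ u v, u ≤ v → g v - g u ≤ v - u) (hgL : ∀ u, g u < L)
      (hgs : ∀ y, y < L → ∃ u, g u = y)
      (Ψ' : B.domain → 𝓢.carrier)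
      (hA1a : ContMDiffOn 𝓘(ℝ, E4) (𝓡 4) ∞ Ψ' {x | τ₁ < B.time x ∧ B.radius x < Rg (B.time x) + 2})
      (hA1b : IsOpenEmbedding
        (Set.restrict {x : B.domain | τ₁ < B.time x ∧ B.radius x < Rg (B.time x) + 2} Ψ'))
      (hA1c : Ψ' '' {x | τ₁ < B.time x ∧ B.radius x < Rg (B.time x) + 2} ⊆ O)
      (W₀ : TopologicalSpace.Opens E4) (Φ : W₀ → 𝓢.carrier)
      (hΦ1 : ContMDiff 𝓘(ℝ, E4) (𝓡 4) ∞ Φ)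
      (hΦ2 : IsOpenEmbedding (Set.restrict {w : W₀ | τf < w.1 0} Φ))
      (hΦ3 : ∀ w : W₀, τf < w.1 0 → Φ w ∈ O) (w₀ : W₀) (P : E4 → Prop)
      (hA3 : ∀ (y : E4) (hy : y ∈ B.domain), τ₁ ≤ y 0 → P y → B.radius y ≤ Rg (B.time y) + 2 →
        ∃ hw : y ∈ W₀, Ψ' ⟨y, hy⟩ = Φ ⟨y, hw⟩)
      (hcollar : ∀ y : E4, y ∈ B.domain → τ₁ + 1 + s < B.time y →
        Rg (B.time y) + 17 / 20 < B.radius y → B.radius y < Rg (B.time y) + 2 →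
        τ₁ ≤ y 0 ∧ τf < y 0 ∧ P y),
    ∃ (σ : ℝ → ℝ → ℝ) (G : E4 → E4) (Gl : B.domain → 𝓢.carrier),
      (∀ t ρ, ρ ≤ b t → σ t ρ = ρ) ∧ (∀ t, StrictMono (σ t)) ∧ (∀ t ρ, σ t ρ < b t + 1 / 2) ∧
      (∀ t ρ, b t ≤ ρ → b t ≤ σ t ρ) ∧ (∀ t t' ρ, t ≤ t' → σ t ρ ≤ σ t' ρ) ∧
      Continuous (fun p : ℝ × ℝ ↦ σ p.1 p.2) ∧ (∀ t ρ, R₁ + 4 < ρ → R₁ + 4 < σ t ρ) ∧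
      (∀ t ρ, b t ≤ ρ → σ t ρ ≤ ρ) ∧
      (∀ y, B.time (G y) = B.time y) ∧
      (∀ y, 0 < B.radius y → B.radius (G y) = σ (B.time y) (B.radius y)) ∧
      (∀ y, 0 < B.radius y → B.radius y ≤ b (B.time y) → G y = y) ∧
      InjOn G {y | 0 < B.radius y} ∧
      (∀ z, R₁ + 4 < B.radius z → (∃ ϱ, B.radius z < σ (B.time z) ϱ) →
        ∃ y, R₁ + 4 < B.radius y ∧ B.time y = B.time z ∧ G y = z) ∧
      ContMDiff 𝓘(ℝ, E4) (𝓡 4) ∞ Gl ∧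
      (∀ x : B.domain, τ₁ + 2 + s ≤ B.time x → B.radius x < b (B.time x) → Gl x = Ψ' x) ∧
      (∀ x : B.domain, τ₁ + 2 + s ≤ B.time x → b (B.time x) ≤ B.radius x →
        ∃ hw : G x ∈ W₀, Gl x = Φ ⟨G x, hw⟩ ∧ τf < G x 0) ∧
      (∀ Tl, τ₁ + 2 + s ≤ Tl →
        IsOpenEmbedding (Set.restrict {x : B.domain | Tl < B.time x} Gl)) ∧
      (∀ x, Gl x ∈ O) := by
  intro B hR₁ hs hτ hdomR hdompos hdomeq Rg hRgm hRgc hRg4 b hb hbm hbRg g L hg hgm hgid hgb hgl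
    hgL hgs Ψ' hA1a hA1b hA1c W₀ Φ hΦ1 hΦ2 hΦ3 w₀ P hA3 hcollar
  have htime : ∀ y, B.time y = poincareInv Λ c y 0 := fun _ ↦ rfl
  have hrad : ∀ y, B.radius y = Kerr.radius a (poincareInv Λ c y) := fun _ ↦ rfl
  have hTc : Continuous B.time := (PiLp.continuous_apply 2 _ 0).comp (continuous_poincareInv Λ c)
  have hRc : Continuous B.radius := (Kerr.continuous_radius a).comp (continuous_poincareInv Λ c)
  -- the push
  obtain ⟨ϑ, hϑ, hϑid, hϑgt, hϑge⟩ := exists_pushProfile (τ₁ + 1 + s)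
  set v : E4 := (Λ : E4 ≃L[ℝ] E4) (E4.basisVector 0) with hv
  set θ : E4 → E4 := fun y ↦ y + (ϑ (B.time y) - B.time y) • v with hθ
  have hθt : ∀ y, B.time (θ y) = ϑ (B.time y) := fun y ↦ by
    simp only [hθ, htime, hv, poincareInv_add_smul]
    simp
  have hθr : ∀ y, B.radius (θ y) = B.radius y := fun y ↦ by
    simp only [hθ, hrad, hv, poincareInv_add_smul, radius_add_smul_e₀]
  have hθ1 : ContDiff ℝ ∞ θ := by
    have ht : ContDiff ℝ ∞ B.time := by
      show ContDiff ℝ ∞ fun y ↦ poincareInv Λ c y 0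
      exact (EuclideanSpace.proj (0 : Fin 4) (𝕜 := ℝ)).contDiff.comp
        (((Λ : E4 ≃L[ℝ] E4).symm : E4 →L[ℝ] E4).contDiff.comp (contDiff_id.sub contDiff_const))
    exact contDiff_id.add (((hϑ.comp ht).sub ht).smul contDiff_const)
  have hθ3 : ∀ y, τ₁ + 1 + s < B.time (θ y) := fun y ↦ by rw [hθt]; exact hϑgt _
  have hθ4 : ∀ y, τ₁ + 2 + s ≤ B.time y → θ y = y := fun y hy ↦ by
    simp only [hθ, hϑid _ (by linarith), sub_self, zero_smul, add_zero]
  have hθ5 : ∀ y, y ∈ B.domain → θ y ∈ B.domain := fun y hy ↦ hdomeq y (θ y) (hθr y) hy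
  -- the squash
  obtain ⟨σ, G, h1, h2, h3, h4, h5, h6, h7, h8, hG1, hG2, hG3, hG4, hG5, hG6, hG7⟩ :=
    exists_labSquash Λ c M a (R₁ + 4) b g L hR₁ hb hbm
      (fun t ↦ by linarith [(hbRg t).1, hRg4 t]) hg hgm hgid hgb hgl hgL hgs
  -- the one-atlas agreement on the collar shell
  have hagree : ∀ y : B.domain, τ₁ + 1 + s < B.time y → b (B.time y) - 1 / 5 < B.radius y →
      B.radius y < b (B.time y) + 1 / 2 →
      ∃ hw : (y : E4) ∈ W₀, Ψ' y = Φ ⟨y, hw⟩ ∧ τf < (y : E4) 0 := by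
    intro y hty hr1 hr2
    have hb1 := (hbRg (B.time y.1)).1
    have hb2 := (hbRg (B.time y.1)).2
    obtain ⟨hy0, hyf, hP⟩ := hcollar y y.2 hty (by linarith) (by linarith)
    obtain ⟨hw, heq⟩ := hA3 y y.2 hy0 hP (by linarith)
    exact ⟨hw, heq, hyf⟩
  obtain ⟨Gl, hGl1, hGl2, hGl3, hGl4, hGl5⟩ := exists_gluedChart O B hTc hRc (R₁ + 4) τ₁ s τf hR₁ b
    hb.continuous (fun t ↦ by linarith [(hbRg t).1, hRg4 t]) hdomR θ hθ1 hθr hθ3 hθ4 hθ5 σ G h1 h3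
    h4 hG1 hG2 hG3 hG4 hG5 hG6 Ψ' {x | τ₁ < B.time x ∧ B.radius x < Rg (B.time x) + 2} hA1a hA1b
    hA1c (fun y hty hr ↦ ⟨by linarith, by linarith [(hbRg (B.time y.1)).2]⟩) W₀ Φ hΦ1 hΦ2 hΦ3 w₀
    hagree
  exact ⟨σ, G, Gl, h1, h2, h3, h4, h5, h6, h7, h8, hG1, hG2, hG3, hG5, hG7, hGl1, hGl2, hGl3, hGl4,
    hGl5⟩

end HoleChart

end Summit.FinalStateConjecture.FinalStateConjecture.Theorems.NecksCertifyTwoCap.Seam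

end
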